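import Summits.BirchSwinnertonDyer.BirchSwinnertonDyer.Theses.KatoDescentTamePotSupersingular
import Summits.BirchSwinnertonDyer.BirchSwinnertonDyer.Theorems.KatoDescentPotSupersingularMemberHullCoreInputsOfFine
import HarnessLib

/-!
# Crux M of route `KatoDescentTamePotSupersingular` (K8-t′) and its HELD child 27962 BY NAME from the hull sub-package, H2X⁺,
# Ferrero–Washington, Lim 3.5 and Imai's finiteness — typed closers over the live aliases
# (crux M = stmt-BirchSwinnertonDyer-19196 `ReducibleKatoMember`; `--supports`, closes nothing)

Seat `bsd-potss-rkm` g30 (prover; cell `bsd-potss`).  HONEST FRAMING: BSD is not proved by any of this; nothing is booked; crux M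
stays cite-level.  What is new (route-free theorem `CoreInputsOfFine.exists_memberHullZetaCoreInputs_of_fineInputs`, this seat): the
held child 27962 `PublishedInputMemberHullZetaCore := Kato2004.exists_memberHullZetaCoreInputs` — the constant behind crux M AND behind
U₀-red's `PublishedInputKatoCorePackageU0RedT` — FOLLOWS from the smaller held hull sub-package `Kato2004.exists_memberHullZetaFineInputs`
(19 abstract-`𝐇²` / `A`-pin fields removed, seat rkm g30, review lane), the one-clause sequel H2X⁺ of bsd-cm's reviewed H2X
(`Kato2004.exists_iwasawaH2Data_fineSelmerDual_embedding_count`, seat rkm g30, review lane), Ferrero–Washington, Lim 2017 Thm. 3.5 and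
Imai's local finiteness (displayed schema, bsd-cm's `hImai` shape).  So on K8-t′:

* `publishedInputMemberHullZetaCore_of_fineInputs : Fine → H2X⁺ → Lim → FW → Imai → PublishedInputMemberHullZetaCore` (27962 by name,
  CONDITIONAL — a re-derivation of the held child, not a discharge);
* `publishedInputKatoCorePackageU0RedT_of_fineInputs : … → PublishedInputKatoCorePackageU0RedT` (U₀-red's copy of the same constant);
* `tameReducibleKatoMember_of_newform_of_fineInputs : exists_isNewformOf → Fine → H2X⁺ → Lim → FW → Imai → ReducibleKatoMember`;
* `tameReducibleKatoMember_of_newformZ_of_fineInputs` — the same keyed to the live alias `PublishedInputNewformKatoZ` (20296).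

References: K. Kato, Astérisque 295 (2004), Thm. 12.5/12.6 (p. 222), Lemma 13.10 (1) (p. 230), Cor. 14.3 / Thm. 14.5 (pp. 235–236),
(14.9.1)–(14.9.3) (pp. 239–240), (14.14.1)–(14.14.2) (p. 243), Prop. 14.16 (2) (pp. 244–245) [Kato2004Asterisque]; H. Imai, Proc. Japan
Acad. 51 (1975) [Imai1975]; C. Wuthrich, Doc. Math. 19 (2014) Lemma 14 [Wuthrich2014].
-/

-- the summit and its single problem are both named `BirchSwinnertonDyer` (registry layout D-0017)
set_option linter.dupNamespace false
set_option autoImplicit false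

noncomputable section

open scoped NumberField
open IsDedekindDomain
open Literature.NumberTheory.EllipticCurves Literature.NumberTheory.EllipticCurves.ModularForms
  Literature.NumberTheory.EllipticCurves.Kato2004 Literature.NumberTheory.GaloisRepresentations
open Summit.BirchSwinnertonDyer.BirchSwinnertonDyer.Theorems

namespace Summit.BirchSwinnertonDyer.BirchSwinnertonDyer.Theorems.FineInputsKT

/-- **The HELD child 27962 `PublishedInputMemberHullZetaCore` (K8-t′) BY NAME from the hull sub-package, H2X⁺, Lim 3.5, FW and Imai's
finiteness** — a CONDITIONAL re-derivation of the held constant `Kato2004.exists_memberHullZetaCoreInputs` (route-free §3 of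
`CoreInputsOfFine`); the abstract-`𝐇²` block of the package is kernel given these atoms.
[cite: Kato2004Asterisque, Thm. 12.5 (3) (p. 222), (14.9.1) (p. 239), (14.9.3) (p. 240), §14.14 (14.14.1)–(14.14.2) (p. 243)] [cite: Imai1975, Theorem (p. 12)] -/
theorem publishedInputMemberHullZetaCore_of_fineInputs (hF : exists_memberHullZetaFineInputs)
    (hH : exists_iwasawaH2Data_fineSelmerDual_embedding_count)
    (hLim : Lim2017.thm35_fineSelmerDual_moduleFinite_of_classicalMuVanishes_of_le_divisionField)
    (hFW : Literature.NumberTheory.IwasawaTheory.ferreroWashington1979_classicalMuVanishes)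
    (hImai : ∀ (W : WeierstrassCurve ℚ) [W.IsElliptic] (p : ℕ) [Fact p.Prime] (κ : ZpExtension ℚ p)
      (v : HeightOneSpectrum (𝓞 ℚ)), 0 ≤ padicValRat p W.j → κ.IsCyclotomic →
      ((Rat.HeightOneSpectrum.primesEquiv v : Nat.Primes) : ℕ) = p →
      Finite (FixedPoints.addSubgroup ↥(κ.kerSubgroup ⊓ GreenbergSelmer.decomp v) (W.geomPrimaryTorsion p))) :
    Summit.BirchSwinnertonDyer.BirchSwinnertonDyer.Theses.KatoDescentTamePotSupersingular.PublishedInputMemberHullZetaCore :=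
  CoreInputsOfFine.exists_memberHullZetaCoreInputs_of_fineInputs hF hH hLim hFW hImai

/-- **U₀-red's copy `PublishedInputKatoCorePackageU0RedT` (K8-t′, the same constant) BY NAME from the same atoms.**
[cite: Kato2004Asterisque, §14.14 (14.14.1)–(14.14.2) (p. 243), proof of Prop. 14.16 (2) (pp. 244–245)] [cite: Imai1975, Theorem (p. 12)] -/
theorem publishedInputKatoCorePackageU0RedT_of_fineInputs (hF : exists_memberHullZetaFineInputs)
    (hH : exists_iwasawaH2Data_fineSelmerDual_embedding_count)
    (hLim : Lim2017.thm35_fineSelmerDual_moduleFinite_of_classicalMuVanishes_of_le_divisionField)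
    (hFW : Literature.NumberTheory.IwasawaTheory.ferreroWashington1979_classicalMuVanishes)
    (hImai : ∀ (W : WeierstrassCurve ℚ) [W.IsElliptic] (p : ℕ) [Fact p.Prime] (κ : ZpExtension ℚ p)
      (v : HeightOneSpectrum (𝓞 ℚ)), 0 ≤ padicValRat p W.j → κ.IsCyclotomic →
      ((Rat.HeightOneSpectrum.primesEquiv v : Nat.Primes) : ℕ) = p →
      Finite (FixedPoints.addSubgroup ↥(κ.kerSubgroup ⊓ GreenbergSelmer.decomp v) (W.geomPrimaryTorsion p))) :
    Summit.BirchSwinnertonDyer.BirchSwinnertonDyer.Theses.KatoDescentTamePotSupersingular.PublishedInputKatoCorePackageU0RedT :=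
  CoreInputsOfFine.exists_memberHullZetaCoreInputs_of_fineInputs hF hH hLim hFW hImai

/-- **Crux M (K8-t′) from modularity, the hull sub-package, H2X⁺, Lim 3.5, FW and Imai's finiteness, Literature-constant form** —
no Gross–Zagier–Kolyvagin, no Poitou–Tate binder, no abstract `𝐇²`.
[cite: Kato2004Asterisque, Thm. 12.5/12.6 (p. 222), Lemma 13.10 (1) (p. 230), Cor. 14.3, Thm. 14.5 (pp. 235–236), (14.9.1)–(14.9.3) (pp. 239–240), (14.14.1)–(14.14.2) (p. 243), Prop. 14.16 (2) (pp. 244–245)]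
[cite: Imai1975, Theorem (p. 12)] [cite: Wuthrich2014, Lemma 14 (p. 396)] -/
theorem tameReducibleKatoMember_of_newform_of_fineInputs (hmod : exists_isNewformOf)
    (hF : exists_memberHullZetaFineInputs) (hH : exists_iwasawaH2Data_fineSelmerDual_embedding_count)
    (hLim : Lim2017.thm35_fineSelmerDual_moduleFinite_of_classicalMuVanishes_of_le_divisionField)
    (hFW : Literature.NumberTheory.IwasawaTheory.ferreroWashington1979_classicalMuVanishes)
    (hImai : ∀ (W : WeierstrassCurve ℚ) [W.IsElliptic] (p : ℕ) [Fact p.Prime] (κ : ZpExtension ℚ p)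
      (v : HeightOneSpectrum (𝓞 ℚ)), 0 ≤ padicValRat p W.j → κ.IsCyclotomic →
      ((Rat.HeightOneSpectrum.primesEquiv v : Nat.Primes) : ℕ) = p →
      Finite (FixedPoints.addSubgroup ↥(κ.kerSubgroup ⊓ GreenbergSelmer.decomp v) (W.geomPrimaryTorsion p))) :
    Summit.BirchSwinnertonDyer.BirchSwinnertonDyer.Theses.KatoDescentTamePotSupersingular.ReducibleKatoMember :=
  CoreInputsOfFine.katoMemberShaBoundOfReducible_of_newform_of_fineInputs hmod hF hH hLim hFW hImai

/-- **Crux M (K8-t′) keyed to the live alias `PublishedInputNewformKatoZ` (20296)** and the new atoms; the GZK child 20298 and the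
Poitou–Tate child 27963 are not used. [cite: Kato2004Asterisque, Cor. 14.3, Thm. 14.5 (pp. 235–236), Prop. 14.16 (2) (pp. 244–245)] [cite: BreuilConradDiamondTaylor2001, Thm. A] -/
theorem tameReducibleKatoMember_of_newformZ_of_fineInputs
    (hmod : Summit.BirchSwinnertonDyer.BirchSwinnertonDyer.Theses.KatoDescentTamePotSupersingular.PublishedInputNewformKatoZ)
    (hF : exists_memberHullZetaFineInputs) (hH : exists_iwasawaH2Data_fineSelmerDual_embedding_count)
    (hLim : Lim2017.thm35_fineSelmerDual_moduleFinite_of_classicalMuVanishes_of_le_divisionField)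
    (hFW : Literature.NumberTheory.IwasawaTheory.ferreroWashington1979_classicalMuVanishes)
    (hImai : ∀ (W : WeierstrassCurve ℚ) [W.IsElliptic] (p : ℕ) [Fact p.Prime] (κ : ZpExtension ℚ p)
      (v : HeightOneSpectrum (𝓞 ℚ)), 0 ≤ padicValRat p W.j → κ.IsCyclotomic →
      ((Rat.HeightOneSpectrum.primesEquiv v : Nat.Primes) : ℕ) = p →
      Finite (FixedPoints.addSubgroup ↥(κ.kerSubgroup ⊓ GreenbergSelmer.decomp v) (W.geomPrimaryTorsion p))) :
    Summit.BirchSwinnertonDyer.BirchSwinnertonDyer.Theses.KatoDescentTamePotSupersingular.ReducibleKatoMember :=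
  tameReducibleKatoMember_of_newform_of_fineInputs hmod hF hH hLim hFW hImai

end Summit.BirchSwinnertonDyer.BirchSwinnertonDyer.Theorems.FineInputsKT

end
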